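import Literature.MathematicalPhysics.QuantumFieldTheory.Balaban1983to89.B6Cov2156TorusDelK
import Literature.MathematicalPhysics.QuantumFieldTheory.Balaban1983to89.B5Hk163TorusHolderRate
import Summits.QuantumFields.BalabanUV.Beta.GAN24.BlockFieldDecay
import Summits.QuantumFields.BalabanUV.Beta.GAN24.AveragedPropagatorTwoLevel

/-!
# `BalabanUV.Beta.GAN24.AveragedPropagatorInverseUniform` — binder row G-an2-4 ∕ (CONV-C), road P2 VECTOR LAYER: the unit-lattice inverse
# `(Q𝒢_aQ*)⁻¹` of the averaged propagator (the VECTOR (U-SINV)) has KERNEL DECAY and a SUP → SUP bound UNIFORM in `n = L^k` and in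
# the torus, for EVERY `a > 0` — because `(Q𝒢_aQ*)⁻¹ = a·1 + Δ_k` (1.65)∕(1.102) and the kernel of `Δ_k` decays (`B5Kernel166Decay`)

NOT IN PRINT; OUR BOOKKEEPING (G-an2-4 formalisation swarm, leaf prover 03, gen 50; CRUX TEAM (2), ruling «YM REDIRECT TOWARDS THE SUMMIT»).
Filed on the road-P2 chair's **INTERFACE REQUEST G-an2-4: (V-SINV, for `(Q𝒢Q*)⁻¹` = the `H_k` denominator ∕ `Δ_K + a`)** (unit
`b2b-balaban-gan24-p2` gen 30, cell `HOME/INBOX.md` block 2026-08-21T11:4xZ l.7851, journal `CLAIMS.log` l.30916; announced by OFFER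
O-gan24leaf03-g50-1, journal l.30733): «`∃ σ > 0, ∀ (n N₀ : ℕ) [NeZero n] [NeZero N₀], 1 ≤ n → ∀ g b, (∀ j, ‖g j‖ ≤ b) → ∀ i,
‖((covOp n (fun _ ⇒ N₀) 1)⁻¹ *ᵥ g) i‖ ≤ σ * b` (every torus welcome; plus the `RowDecay` form … if cheap)» — §5 states both LITERALLY
(`covOp_inv_sup_one_cubic`, `covOp_inv_sup_one`, `covOp_inv_rowDecay_one`), as corollaries of the every-`a`, every-torus §3–§4.  The
requester's suggested road (entry decay of `covOp` + Combes–Thomas on the unit torus, as in the scalar `SavgInverseUniform`) is NOT needed: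
the inverse is explicit.

WHAT (every dimension `d + 1 ≥ 1`, every torus `M`, every `n ≥ 1`, every `a > 0`; `QGQ n hn M a ha := QvOp · calG · QvAdj` is
`Beta.FluctuationProjection.QGQ` = Bałaban's `Q𝒢_aQ*`, `𝒢_a = Δ_a⁻¹` (1.71); `rep` = the box representative of a unit site):
 * §1 dictionary: `res M (rep t) = torFin t` and **`pdist M (rep s) (rep t) = |rep s − rep t|_{T,∞}`** (B6's periodic bond distance IS the
   engine's torus sup-distance on box representatives — `B5DPD126Uniform.tdist_eq_torusSupNorm`);
 * §2 **`exists_DelK_kernel_decay`**: `∃ c₀ δ₀ > 0` (d-only) `∀ n M a q′ q, ‖Δ_k(q′, q)‖ ≤ c₀·e^{−δ₀|rep q′₁ − rep q₁|_T}` — `B5Kernel166Decay.kernelDecay166_succ`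
   (the (1.66) symbol's strip analyticity, pv15) read through `B6Cov2156TorusDelK.DelK_eq_reindex_deltaPol`;
 * §3 **`QGQ_inv_apply`**: `(Q𝒢_aQ*)⁻¹(q′, q) = a·δ_{q′q} + Δ_k(q′, q)` (`Beta.BlockEffectiveAction.QGQ_inv_eq`, (1.65) = `(QGQ*)⁻¹ − a`);
   **`exists_QGQ_inv_kernel`**: `∃ c₀ δ₀ > 0 ∀ n M a q′ q, ‖(Q𝒢_aQ*)⁻¹(q′, q)‖ ≤ (a + c₀)·e^{−δ₀|rep q′₁ − rep q₁|_T}`;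
   **`exists_QGQ_inv_rowDecay`**: the same in road P2's `BlockFieldDecay.RowDecay M Prod.fst Prod.fst` currency with constant `(d+1)·(a + c₀)`;
   **`exists_QGQ_inv_sup`**: `∃ c₀ δ₀ > 0 ∀ n M a v b, |v| ≤ b ⟹ ‖((Q𝒢_aQ*)⁻¹ v)(q′)‖ ≤ (d+1)·(a + c₀)·latticeConst(d+1, δ₀)·b` — the vector (U-SINV)
   sup form, uniformly in `n` and the volume (`B5Hk163TorusHolderRate.sum_exp_torusSupNorm_sub_rep_le`).
 * §4 the same three forms for road P2's `covOp n M a = QvOp·(DeltaA)⁻¹·QvAdj` (`AveragedPropagatorTwoLevel`; `covOp_eq_QGQ` is the one-line dictionary):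
   `exists_covOp_inv_rowDecay` ∕ `exists_covOp_inv_sup` ∕ `exists_covOp_inv_kernel`;
 * §5 THE REQUESTED SHAPES at `a = 1`, verbatim: `covOp_inv_sup_one_cubic` (cubic), `covOp_inv_sup_one` (every torus), `covOp_inv_rowDecay_one`.
No Combes–Thomas argument is needed (contrast the scalar (U-SINV) `GAN24/SavgInverseUniform`): the inverse is EXPLICIT, `a + Δ_k`.

HONEST SCOPE.  [folklore] composition of tree theorems BY NAME; `U = 1`; constants existential in size but d-only (`c₀, δ₀` of pv15's
`kernelDecay166`), `a` enters linearly; NOT (CONV-C) (a list), NEVER «G-an2-4 closed», NOT NE2, NOT D1, NOT BetaPertH, NOT continuum, NOT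
Clay.  HONEST DEPENDENCY (cell records, verbatim): «continuum YM on T⁴ ⇐ BetaPertH ∧ nine spine estimates (0/9 proved); BetaPertH ⇐ (D1) ∧
(D4) ∧ CAP+tail; G-an2-4 gates asym, D1 and NE2/3/4.»  ABSOLUTE RULE kept: no statement of the papers is a hypothesis; 0 `sorry`.  Locators
(text only): [Balaban1984PropagatorsI] (1.65)–(1.66) p. 29, (1.100)–(1.103) p. 34; [Balaban1984PropagatorsII] p. 250 («C*Δ_kC has the same
exponential decay as Δ_k»).  Provenance: prover-b2b-balaban-gan24-formalise-leaf-03-g50-0, 2026-08-21.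
-/

noncomputable section

open scoped BigOperators ComplexConjugate Matrix
open Finset

namespace Summit.QuantumFields.BalabanUV.Beta.GAN24.AveragedPropagatorInverseUniform

open Literature.MathematicalPhysics.QuantumFieldTheory.Balaban1983to89
open B5Prop11Plancherel (Tor)
open B4TorusKernel.MultiPeriod (torusSupNorm torusSupNorm_nonneg)
open B4Sect5Proof (latticeConst latticeConst_nonneg)
open B4Sect5Torus (tdist circAbs_zero)
open B5QGGQ145Bounds (toZ)
open B5DPD126Uniform (tdist_eq_torusSupNorm)
open B6BondEliminationTorus (res pdist)
open B6LowerBound2153Torus (rep rep_mem_pbox)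
open B6Cov2156Torus (one_le_M deltaPol KernelDecay)
open B6Cov2156TorusDelK (idxEquiv idxEquiv_symm_apply DelK_eq_reindex_deltaPol)
open B5Kernel166Decay (torFin kernelDecay166_succ)
open B5Hk163TorusHolderRate (toZ_torFin sum_exp_torusSupNorm_sub_rep_le)
open Beta.FluctuationProjection (QGQ)
open Beta.BlockEffectiveAction (DelK QGQ_inv_eq)
open Summit.QuantumFields.BalabanUV.Beta.GAN24.BlockFieldDecay (RowDecay)
open Summit.QuantumFields.BalabanUV.Beta.GAN24.AveragedPropagatorTwoLevel (covOp)
open B5DeltaA169 (calG_eq_DeltaA_inv)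

variable {d : ℕ}

/-! ## §1 Dictionary: B6's periodic bond distance on box representatives = the engine's torus sup-distance -/

section Dictionary

variable (M : Fin (d + 1) → ℕ) [hM : ∀ μ, NeZero (M μ)]

/-- the residue map of `B6BondEliminationTorus` on a box representative is the canonical grid point `torFin`. [folklore] -/
theorem res_rep (t : Tor M) : res M (one_le_M M) (rep M t) = torFin M t := by
  funext i
  apply Fin.ext
  have hlt : (t i).val < M i := ZMod.val_lt (t i)
  have h0 : (0 : ℤ) ≤ ((t i).val : ℤ) := by exact_mod_cast Nat.zero_le _
  have h1 : (((t i).val : ℤ)) < (M i : ℤ) := by exact_mod_cast hlt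
  show ((((t i).val : ℤ)) % (M i : ℤ)).toNat = (t i).val
  rw [Int.emod_eq_of_lt h0 h1, Int.toNat_natCast]

/-- **`ρ_M(rep s, rep t) = |rep s − rep t|_{T,∞}`**. [folklore] -/
theorem pdist_rep_rep (s t : Tor M) :
    pdist M (one_le_M M) (rep M s) (rep M t) = torusSupNorm M (rep M s - rep M t) := by
  show tdist M (res M (one_le_M M) (rep M s)) (res M (one_le_M M) (rep M t)) = _
  rw [res_rep, res_rep, tdist_eq_torusSupNorm (one_le_M M), toZ_torFin, toZ_torFin]

omit hM in
/-- `|0|_{T,∞} = 0` (a local copy of a two-line fact, stated for `x − x`). [folklore] -/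
theorem torusSupNorm_sub_self (x : Fin (d + 1) → ℤ) : torusSupNorm M (x - x) = 0 := by
  rw [sub_self]
  unfold torusSupNorm
  have : (fun i : Fin (d + 1) => ((B4TorusKernel.MultiPeriod.circAbs (M i) ((0 : Fin (d + 1) → ℤ) i) : ℤ) : ℝ)) = fun _ => 0 := by
    funext i
    rw [Pi.zero_apply, circAbs_zero, Int.cast_zero]
  rw [this, Finset.sup'_const]

end Dictionary

/-! ## §2 The kernel of `Δ_k` decays, d-only constants, every torus, every `n`, every `a` -/

section DelKDecay

variable (n : ℕ) [NeZero n] (hn : 1 ≤ n) (M : Fin (d + 1) → ℕ) [hM : ∀ μ, NeZero (M μ)] (a : ℝ) (ha : 0 < a)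

/-- the entries of `Δ_k` ARE the entries of B6's `deltaPol` on box representatives (`DelK_eq_reindex_deltaPol`). [folklore] -/
theorem DelK_apply (q' q : Tor M × Fin (d + 1)) :
    DelK n hn M a ha q' q = ((deltaPol M n ((idxEquiv M).symm q') ((idxEquiv M).symm q) : ℝ) : ℂ) := by
  rw [DelK_eq_reindex_deltaPol n hn M a ha]
  rfl

omit n hn M hM a ha in
/-- **KERNEL DECAY OF `Δ_k` IN TORUS COORDINATES**: `∃ c₀ δ₀ > 0` (functions of `d` alone) such that for every `n ≥ 1`, every torus `M`, every
`a > 0` and all bonds `q′, q` of the unit torus, `‖Δ_k(q′, q)‖ ≤ c₀·e^{−δ₀|rep q′₁ − rep q₁|_{T,∞}}` — `B5Kernel166Decay.kernelDecay166_succ` BY NAME,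
read through §1. [folklore] -/
theorem exists_DelK_kernel_decay :
    ∃ c₀ δ₀ : ℝ, 0 < c₀ ∧ 0 < δ₀ ∧
      ∀ (n : ℕ) [NeZero n] (hn : 1 ≤ n) (M : Fin (d + 1) → ℕ) [∀ μ, NeZero (M μ)] (a : ℝ) (ha : 0 < a)
        (q' q : Tor M × Fin (d + 1)),
        ‖DelK n hn M a ha q' q‖ ≤ c₀ * Real.exp (-(δ₀ * torusSupNorm M (rep M q'.1 - rep M q.1))) := by
  obtain ⟨c₀, δ₀, hc, hδ, h⟩ := kernelDecay166_succ (d := d)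
  refine ⟨c₀, δ₀, hc, hδ, fun n _ hn M _ a ha q' q => ?_⟩
  have hK := h M n hn ((idxEquiv M).symm q') ((idxEquiv M).symm q)
  rw [idxEquiv_symm_apply, idxEquiv_symm_apply] at hK
  rw [DelK_apply, Complex.norm_real, Real.norm_eq_abs, idxEquiv_symm_apply, idxEquiv_symm_apply, ← pdist_rep_rep M q'.1 q.1]
  exact hK

end DelKDecay

/-! ## §3 The vector (U-SINV): kernel, `RowDecay` and sup forms of `(Q𝒢_aQ*)⁻¹ = a + Δ_k` -/

section Inverse

variable (n : ℕ) [NeZero n] (hn : 1 ≤ n) (M : Fin (d + 1) → ℕ) [hM : ∀ μ, NeZero (M μ)] (a : ℝ) (ha : 0 < a)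

/-- **`(Q𝒢_aQ*)⁻¹(q′, q) = a·δ_{q′q} + Δ_k(q′, q)`** ((1.65) read as `(QGQ*)⁻¹ = a + Δ_k`, `Beta.BlockEffectiveAction.QGQ_inv_eq`). [folklore] -/
theorem QGQ_inv_apply (q' q : Tor M × Fin (d + 1)) :
    (QGQ n hn M a ha)⁻¹ q' q = (if q' = q then (a : ℂ) else 0) + DelK n hn M a ha q' q := by
  rw [QGQ_inv_eq, Matrix.add_apply, Matrix.smul_apply, Matrix.one_apply, smul_eq_mul, mul_ite, mul_one, mul_zero]

omit n hn M hM a ha in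
/-- **THE VECTOR (U-SINV), KERNEL FORM**: `∃ c₀ δ₀ > 0` (d-only) such that for every `n ≥ 1`, torus `M`, `a > 0`, bonds `q′, q`,
`‖(Q𝒢_aQ*)⁻¹(q′, q)‖ ≤ (a + c₀)·e^{−δ₀|rep q′₁ − rep q₁|_{T,∞}}`. [folklore] -/
theorem exists_QGQ_inv_kernel :
    ∃ c₀ δ₀ : ℝ, 0 < c₀ ∧ 0 < δ₀ ∧
      ∀ (n : ℕ) [NeZero n] (hn : 1 ≤ n) (M : Fin (d + 1) → ℕ) [∀ μ, NeZero (M μ)] (a : ℝ) (ha : 0 < a)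
        (q' q : Tor M × Fin (d + 1)),
        ‖(QGQ n hn M a ha)⁻¹ q' q‖ ≤ (a + c₀) * Real.exp (-(δ₀ * torusSupNorm M (rep M q'.1 - rep M q.1))) := by
  obtain ⟨c₀, δ₀, hc, hδ, h⟩ := exists_DelK_kernel_decay (d := d)
  refine ⟨c₀, δ₀, hc, hδ, fun n _ hn M _ a ha q' q => ?_⟩
  have hD := h n hn M a ha q' q
  have hE : 0 ≤ Real.exp (-(δ₀ * torusSupNorm M (rep M q'.1 - rep M q.1))) := (Real.exp_pos _).le
  rw [QGQ_inv_apply]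
  refine (norm_add_le _ _).trans ?_
  by_cases hq : q' = q
  · subst hq
    rw [if_pos rfl, Complex.norm_real, Real.norm_of_nonneg ha.le, torusSupNorm_sub_self, mul_zero, neg_zero,
      Real.exp_zero, mul_one]
    rw [torusSupNorm_sub_self, mul_zero, neg_zero, Real.exp_zero, mul_one] at hD
    linarith
  · rw [if_neg hq, norm_zero, zero_add, add_mul]
    have : 0 ≤ a * Real.exp (-(δ₀ * torusSupNorm M (rep M q'.1 - rep M q.1))) := mul_nonneg ha.le hE
    linarith

omit n hn M hM a ha in
/-- **THE VECTOR (U-SINV) IN ROAD P2's `RowDecay` CURRENCY**: `∃ c₀ δ₀ > 0` (d-only) such that for every `n ≥ 1`, torus `M`, `a > 0`,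
`RowDecay M Prod.fst Prod.fst (Q𝒢_aQ*)⁻¹ ((d+1)·(a + c₀)) δ₀` — the per-site block rows (all `d+1` components at a site) of the unit-lattice
inverse decay. [folklore] -/
theorem exists_QGQ_inv_rowDecay :
    ∃ c₀ δ₀ : ℝ, 0 < c₀ ∧ 0 < δ₀ ∧
      ∀ (n : ℕ) [NeZero n] (hn : 1 ≤ n) (M : Fin (d + 1) → ℕ) [∀ μ, NeZero (M μ)] (a : ℝ) (ha : 0 < a),
        RowDecay M Prod.fst Prod.fst (QGQ n hn M a ha)⁻¹ ((d + 1) * (a + c₀)) δ₀ := by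
  obtain ⟨c₀, δ₀, hc, hδ, h⟩ := exists_QGQ_inv_kernel (d := d)
  refine ⟨c₀, δ₀, hc, hδ, fun n _ hn M _ a ha x y' => ?_⟩
  -- the block row at the unit site `y′`: the `d+1` components `(y′, λ)`
  have hterm : ∀ x' : Tor M × Fin (d + 1),
      (if x'.1 = y' then ‖(QGQ n hn M a ha)⁻¹ x x'‖ else 0)
        ≤ if x'.1 = y' then (a + c₀) * Real.exp (-(δ₀ * torusSupNorm M (rep M x.1 - rep M y'))) else 0 := by
    intro x'
    split_ifs with hx
    · rw [← hx]; exact h n hn M a ha x x'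
    · exact le_rfl
  calc (∑ x' : Tor M × Fin (d + 1), if x'.1 = y' then ‖(QGQ n hn M a ha)⁻¹ x x'‖ else 0)
      ≤ ∑ x' : Tor M × Fin (d + 1),
          (if x'.1 = y' then (a + c₀) * Real.exp (-(δ₀ * torusSupNorm M (rep M x.1 - rep M y'))) else 0) :=
        Finset.sum_le_sum fun x' _ => hterm x'
    _ = (d + 1) * ((a + c₀) * Real.exp (-(δ₀ * torusSupNorm M (rep M x.1 - rep M y')))) := by
        rw [Fintype.sum_prod_type]
        have inner : ∀ x₁ : Tor M,
            (∑ _x₂ : Fin (d + 1),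
                (if x₁ = y' then (a + c₀) * Real.exp (-(δ₀ * torusSupNorm M (rep M x.1 - rep M y'))) else (0 : ℝ)))
              = if x₁ = y' then ((d : ℝ) + 1) * ((a + c₀) * Real.exp (-(δ₀ * torusSupNorm M (rep M x.1 - rep M y'))))
                else 0 := by
          intro x₁
          split_ifs
          · rw [Finset.sum_const, Finset.card_univ, Fintype.card_fin, nsmul_eq_mul]; push_cast; ring
          · simp
        simp_rw [inner]
        rw [Finset.sum_ite_eq' Finset.univ y', if_pos (Finset.mem_univ _)]
    _ = (d + 1) * (a + c₀) * Real.exp (-(δ₀ * torusSupNorm M (rep M x.1 - rep M y'))) := by ring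

omit n hn M hM a ha in
/-- **THE VECTOR (U-SINV), SUP FORM**: `∃ c₀ δ₀ > 0` (d-only) such that for every `n ≥ 1`, torus `M`, `a > 0`, every bounded unit-lattice
1-form `v` (`|v(q)| ≤ b`) and every bond `q′`, `‖((Q𝒢_aQ*)⁻¹ v)(q′)‖ ≤ (d+1)·(a + c₀)·latticeConst(d+1, δ₀)·b` — uniformly in `n` and in
the volume. [folklore] -/
theorem exists_QGQ_inv_sup :
    ∃ c₀ δ₀ : ℝ, 0 < c₀ ∧ 0 < δ₀ ∧
      ∀ (n : ℕ) [NeZero n] (hn : 1 ≤ n) (M : Fin (d + 1) → ℕ) [∀ μ, NeZero (M μ)] (a : ℝ) (ha : 0 < a)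
        (v : Tor M × Fin (d + 1) → ℂ) (b : ℝ), (∀ q, ‖v q‖ ≤ b) →
        ∀ q' : Tor M × Fin (d + 1),
          ‖((QGQ n hn M a ha)⁻¹ *ᵥ v) q'‖ ≤ (d + 1) * (a + c₀) * latticeConst (d + 1) δ₀ * b := by
  obtain ⟨c₀, δ₀, hc, hδ, h⟩ := exists_QGQ_inv_kernel (d := d)
  refine ⟨c₀, δ₀, hc, hδ, fun n _ hn M _ a ha v b hv q' => ?_⟩
  have hb : 0 ≤ b := (norm_nonneg _).trans (hv q')
  have hac : 0 ≤ a + c₀ := by linarith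
  have hS := sum_exp_torusSupNorm_sub_rep_le M hδ (rep M q'.1)
  calc ‖((QGQ n hn M a ha)⁻¹ *ᵥ v) q'‖
      = ‖∑ q : Tor M × Fin (d + 1), (QGQ n hn M a ha)⁻¹ q' q * v q‖ := rfl
    _ ≤ ∑ q : Tor M × Fin (d + 1), ‖(QGQ n hn M a ha)⁻¹ q' q‖ * b := by
        refine (norm_sum_le _ _).trans (Finset.sum_le_sum fun q _ => ?_)
        rw [norm_mul]
        exact mul_le_mul_of_nonneg_left (hv q) (norm_nonneg _)
    _ ≤ ∑ q : Tor M × Fin (d + 1), (a + c₀) * Real.exp (-(δ₀ * torusSupNorm M (rep M q'.1 - rep M q.1))) * b :=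
        Finset.sum_le_sum fun q _ => mul_le_mul_of_nonneg_right (h n hn M a ha q' q) hb
    _ = (d + 1) * (a + c₀) * (∑ t : Tor M, Real.exp (-(δ₀ * torusSupNorm M (rep M q'.1 - rep M t)))) * b := by
        rw [Fintype.sum_prod_type]
        simp only [Finset.sum_const, Finset.card_univ, Fintype.card_fin, nsmul_eq_mul, Finset.mul_sum, Finset.sum_mul]
        refine Finset.sum_congr rfl fun t _ => ?_
        push_cast
        ring
    _ ≤ (d + 1) * (a + c₀) * latticeConst (d + 1) δ₀ * b := by
        have h0 : (0 : ℝ) ≤ (d + 1) * (a + c₀) := by positivity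
        exact mul_le_mul_of_nonneg_right (mul_le_mul_of_nonneg_left hS h0) hb

end Inverse

/-! ## §4 The same in road P2's letters: `covOp n M a = QvOp·(DeltaA)⁻¹·QvAdj` (gan24-p2-g30, `AveragedPropagatorTwoLevel`) -/

section RoadP2

variable (n : ℕ) [NeZero n] (M : Fin (d + 1) → ℕ) [hM : ∀ μ, NeZero (M μ)] (a : ℝ)

/-- DICTIONARY: road P2's `covOp n M a` IS the β sub-cell's `QGQ n hn M a ha` («G = Δ_a⁻¹», `B5DeltaA169.calG_eq_DeltaA_inv`). [folklore] -/
theorem covOp_eq_QGQ (hn : 1 ≤ n) (ha : 0 < a) : covOp n M a = QGQ n hn M a ha := by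
  rw [covOp, QGQ, calG_eq_DeltaA_inv]

omit n M hM a in
/-- **THE VECTOR (U-SINV) FOR `covOp`, `RowDecay` FORM**: `∃ c₀ δ₀ > 0` (d-only), for every `n ≥ 1`, torus `M`, `a > 0`:
`RowDecay M Prod.fst Prod.fst (covOp n M a)⁻¹ ((d+1)·(a + c₀)) δ₀`. [folklore] -/
theorem exists_covOp_inv_rowDecay :
    ∃ c₀ δ₀ : ℝ, 0 < c₀ ∧ 0 < δ₀ ∧
      ∀ (n : ℕ) [NeZero n] (M : Fin (d + 1) → ℕ) [∀ μ, NeZero (M μ)] (a : ℝ), 0 < a →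
        RowDecay M Prod.fst Prod.fst (covOp n M a)⁻¹ ((d + 1) * (a + c₀)) δ₀ := by
  obtain ⟨c₀, δ₀, hc, hδ, h⟩ := exists_QGQ_inv_rowDecay (d := d)
  refine ⟨c₀, δ₀, hc, hδ, fun n _ M _ a ha => ?_⟩
  rw [covOp_eq_QGQ n M a (Nat.one_le_iff_ne_zero.mpr (NeZero.ne n)) ha]
  exact h n _ M a ha

omit n M hM a in
/-- **THE VECTOR (U-SINV) FOR `covOp`, SUP FORM**: `∃ c₀ δ₀ > 0` (d-only), for every `n ≥ 1`, torus `M`, `a > 0`, every bounded 1-form `v`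
(`|v| ≤ b`) and every bond `q′`: `‖((covOp n M a)⁻¹ v)(q′)‖ ≤ (d+1)·(a + c₀)·latticeConst(d+1, δ₀)·b`. [folklore] -/
theorem exists_covOp_inv_sup :
    ∃ c₀ δ₀ : ℝ, 0 < c₀ ∧ 0 < δ₀ ∧
      ∀ (n : ℕ) [NeZero n] (M : Fin (d + 1) → ℕ) [∀ μ, NeZero (M μ)] (a : ℝ), 0 < a →
        ∀ (v : Tor M × Fin (d + 1) → ℂ) (b : ℝ), (∀ q, ‖v q‖ ≤ b) →
          ∀ q' : Tor M × Fin (d + 1), ‖((covOp n M a)⁻¹ *ᵥ v) q'‖ ≤ (d + 1) * (a + c₀) * latticeConst (d + 1) δ₀ * b := by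
  obtain ⟨c₀, δ₀, hc, hδ, h⟩ := exists_QGQ_inv_sup (d := d)
  refine ⟨c₀, δ₀, hc, hδ, fun n _ M _ a ha v b hv q' => ?_⟩
  rw [covOp_eq_QGQ n M a (Nat.one_le_iff_ne_zero.mpr (NeZero.ne n)) ha]
  exact h n _ M a ha v b hv q'

omit n M hM a in
/-- **THE VECTOR (U-SINV) FOR `covOp`, KERNEL FORM**: `‖(covOp n M a)⁻¹ q′ q‖ ≤ (a + c₀)·e^{−δ₀|rep q′₁ − rep q₁|_T}`. [folklore] -/
theorem exists_covOp_inv_kernel :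
    ∃ c₀ δ₀ : ℝ, 0 < c₀ ∧ 0 < δ₀ ∧
      ∀ (n : ℕ) [NeZero n] (M : Fin (d + 1) → ℕ) [∀ μ, NeZero (M μ)] (a : ℝ), 0 < a →
        ∀ q' q : Tor M × Fin (d + 1),
          ‖(covOp n M a)⁻¹ q' q‖ ≤ (a + c₀) * Real.exp (-(δ₀ * torusSupNorm M (rep M q'.1 - rep M q.1))) := by
  obtain ⟨c₀, δ₀, hc, hδ, h⟩ := exists_QGQ_inv_kernel (d := d)
  refine ⟨c₀, δ₀, hc, hδ, fun n _ M _ a ha q' q => ?_⟩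
  rw [covOp_eq_QGQ n M a (Nat.one_le_iff_ne_zero.mpr (NeZero.ne n)) ha]
  exact h n _ M a ha q' q

end RoadP2

/-! ## §5 THE REQUESTED SHAPES (V-SINV), literally: `a = 1`, cubic and general tori -/

section Requested

/-- **(V-SINV) AS REQUESTED — sup form, `a = 1`, CUBIC unit tori** (gan24-p2-g30, INBOX 2026-08-21 l.7851, verbatim shape):
`∃ σ > 0, ∀ n N₀ ≥ 1, ∀ g b, |g| ≤ b → ∀ i, ‖((covOp n (fun _ ⇒ N₀) 1)⁻¹ g)(i)‖ ≤ σ·b`; `σ = (d+1)·(1 + c₀)·latticeConst(d+1, δ₀) + 1`, a function of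
`d` alone. [folklore] -/
theorem covOp_inv_sup_one_cubic :
    ∃ σ : ℝ, 0 < σ ∧ ∀ (n N₀ : ℕ) [NeZero n] [NeZero N₀], 1 ≤ n →
      ∀ (g : Tor (fun _ : Fin (d + 1) => N₀) × Fin (d + 1) → ℂ) (b : ℝ), (∀ j, ‖g j‖ ≤ b) →
        ∀ i : Tor (fun _ : Fin (d + 1) => N₀) × Fin (d + 1),
          ‖((covOp n (fun _ : Fin (d + 1) => N₀) 1)⁻¹ *ᵥ g) i‖ ≤ σ * b := by
  obtain ⟨c₀, δ₀, hc, hδ, h⟩ := exists_covOp_inv_sup (d := d)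
  refine ⟨(d + 1) * (1 + c₀) * latticeConst (d + 1) δ₀ + 1, ?_, fun n N₀ _ _ _ g b hg i => ?_⟩
  · have h0 : (0 : ℝ) ≤ (d + 1) * (1 + c₀) * latticeConst (d + 1) δ₀ := by
      have := latticeConst_nonneg (d + 1) hδ.le
      positivity
    linarith
  have hb : 0 ≤ b := (norm_nonneg _).trans (hg i)
  have h1 := h n (fun _ : Fin (d + 1) => N₀) 1 one_pos g b hg i
  nlinarith

/-- **(V-SINV), sup form, `a = 1`, EVERY torus** («every torus welcome»): the same `σ(d)` for all period vectors `T`. [folklore] -/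
theorem covOp_inv_sup_one :
    ∃ σ : ℝ, 0 < σ ∧ ∀ (n : ℕ) [NeZero n] (T : Fin (d + 1) → ℕ) [∀ μ, NeZero (T μ)], 1 ≤ n →
      ∀ (g : Tor T × Fin (d + 1) → ℂ) (b : ℝ), (∀ j, ‖g j‖ ≤ b) →
        ∀ i : Tor T × Fin (d + 1), ‖((covOp n T 1)⁻¹ *ᵥ g) i‖ ≤ σ * b := by
  obtain ⟨c₀, δ₀, hc, hδ, h⟩ := exists_covOp_inv_sup (d := d)
  refine ⟨(d + 1) * (1 + c₀) * latticeConst (d + 1) δ₀ + 1, ?_, fun n _ T _ _ g b hg i => ?_⟩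
  · have h0 : (0 : ℝ) ≤ (d + 1) * (1 + c₀) * latticeConst (d + 1) δ₀ := by
      have := latticeConst_nonneg (d + 1) hδ.le
      positivity
    linarith
  have hb : 0 ≤ b := (norm_nonneg _).trans (hg i)
  have h1 := h n T 1 one_pos g b hg i
  nlinarith

/-- **(V-SINV), `RowDecay` form, `a = 1`, EVERY torus** («plus the `RowDecay` form `RowDecay T Prod.fst Prod.fst (covOp n T 1)⁻¹ σ δ` if cheap» —
it is): `σ = (d+1)·(1 + c₀)`, `δ = δ₀`, both functions of `d` alone. [folklore] -/
theorem covOp_inv_rowDecay_one :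
    ∃ σ δ : ℝ, 0 < σ ∧ 0 < δ ∧ ∀ (n : ℕ) [NeZero n] (T : Fin (d + 1) → ℕ) [∀ μ, NeZero (T μ)], 1 ≤ n →
      RowDecay T Prod.fst Prod.fst (covOp n T 1)⁻¹ σ δ := by
  obtain ⟨c₀, δ₀, hc, hδ, h⟩ := exists_covOp_inv_rowDecay (d := d)
  exact ⟨(d + 1) * (1 + c₀), δ₀, by positivity, hδ, fun n _ T _ _ => h n T 1 one_pos⟩

end Requested

end Summit.QuantumFields.BalabanUV.Beta.GAN24.AveragedPropagatorInverseUniform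

end
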